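import Literature.NumberTheory.Transcendental.NesterenkoMultiplicityToolkit
import Literature.NumberTheory.Transcendental.NesterenkoEliminationProp44K
import Literature.RingTheory.HilbertSamuel.PolynomialRing
import Literature.RingTheory.KrullDimension.AffineCatenary
import Literature.NumberTheory.Transcendental.PhilipponCriterionPrincipal
import Mathlib.RingTheory.Ideal.AssociatedPrime.Basic
import Mathlib.RingTheory.Polynomial.UniqueFactorization
import Mathlib.Algebra.MvPolynomial.Nilpotent
import Mathlib.LinearAlgebra.FiniteDimensional.Lemmas
import HarnessLib

/-!
# Nesterenko's multiplicity estimate (LNM 1752 Ch. 10): Lemma 3.2, Corollary 3.3, and generalities on forms over `K = ℂ(z)` — proofs only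

`Literature/NumberTheory/Transcendental/NesterenkoMultiplicityLemma32.lean` — proofs only (no
definitions, no named facts, nothing asserted). Part of the discharge of
`NesterenkoMultiplicity.NesterenkoPhilippon2001_ch10_thm_1_1` along the printed proof (Ch. 10 §3,
p. 154), on top of the toolkit predicate `CzToolkit` (`NesterenkoMultiplicityToolkit.lean`):

* generalities: principal ideals of `K[x₀, …, x_m]` are unmixed of rank `m` over any field
  (`isUnmixedOfRank_span_singleton`, the standing assumption of Ch. 3 Prop. 4.8; the tree's
  `PhilipponMain.isUnmixedOfRank_span_singleton` is the case `K = ℚ`), a form of degree `≥ 1` is not a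
  unit, `zDeg_homogTo_le` (`deg_z (x₀ⁿ A(x/x₀)) ≤ deg_z A`), `one_le_ideg_of_isPrime` (`deg 𝔭 ≥ 1`, from the
  irreducibility of the associated form, Prop. 4.4 over any field, `NesterenkoK.prop_4_4`),
  `isMinimalPrimaryDecomposition_singleton`;
* `𝓛(μ, ν)`: `Lcal_eq_range` / `LcalParam_injective` (every form of `x̲`-degree `ν` with `deg_z ≤ μ` is
  uniquely `Σ_{a ≤ μ} zᵃ H_a` with complex forms `H_a`), `finite_Lcal`, **`finrank_Lcal`**
  (`dim_ℂ 𝓛(μ, ν) = (μ + 1) binom(ν + m, m)`, p. 154), `finite_LcalMod`;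
* **`exists_mem_Lcal_toK_mem`** ((53) ⇒ a non-zero `P ∈ 𝓛(μ, ν)` with residue `0` mod `𝔭`, rank–nullity),
  `pow_lt_factorial_mul_choose` (`m! binom(ν+m, m) > νᵐ`);
* **`lemma_3_2`** — LNM 1752 Ch. 10 Lemma 3.2 from the field `lemma_3_1` of the toolkit and (52);
* **`cor_3_3_ineq`** — the parameters (54) of Corollary 3.3 satisfy (52).

## References

* [NesterenkoPhilippon2001] Yu. V. Nesterenko, P. Philippon (eds.), *Introduction to Algebraic
  Independence Theory*, LNM 1752, Springer 2001, Ch. 10 §3, Lemma 3.2, Corollary 3.3 and their proofs,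
  (52)–(54) (p. 154); Ch. 3 Prop. 4.4, Def. 4.5, Prop. 4.8 (pp. 38–40).
-/

noncomputable section

open MvPolynomial
open scoped Polynomial

namespace Literature.NumberTheory.Transcendental

namespace NesterenkoMultiplicity

variable {m : ℕ}

/-! ## Lemma 3.2 and Corollary 3.3 of LNM 1752 Ch. 10 (p. 154) — proofs only -/

section Lemma32

open Literature.NumberTheory.Transcendental.NesterenkoK Module

attribute [local instance] MvPolynomial.gradedAlgebra

/-! ### Principal ideals of `K[x₀, …, x_m]` are unmixed of rank `m` (generic field) -/

/-- **Principal ideals of `K[x₀, …, x_m]` (`K` a field) are unmixed of rank `m`**: for `E ≠ 0` not a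
unit, every associated prime of `(E)` is `(p)` for a prime factor `p` of `E`, and `dim K[x̲] ⧸ (p) = m`
— the standing assumption "let `I = (P)` be a principal ideal" of Ch. 3 Prop. 4.8, here for `K = ℂ(z)`
(the tree's `PhilipponMain.isUnmixedOfRank_span_singleton` is the case `K = ℚ`).
[cite: NesterenkoPhilippon2001, Ch. 3 Prop. 4.8 (p. 40)] -/
theorem isUnmixedOfRank_span_singleton {K : Type*} [Field K] {E : MvPolynomial (Fin (m + 1)) K}
    (hE0 : E ≠ 0) (hEu : ¬ IsUnit E) : IsUnmixedOfRank (Ideal.span {E}) m := by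
  classical
  letI : GCDMonoid (MvPolynomial (Fin (m + 1)) K) :=
    UniqueFactorizationMonoid.toGCDMonoid (MvPolynomial (Fin (m + 1)) K)
  refine ⟨?_, fun 𝔭 h𝔭 => ?_⟩
  · rwa [Ne, Ideal.span_singleton_eq_top]
  · obtain ⟨hprime, x, hx⟩ := Submodule.isAssociatedPrime_iff.mp h𝔭
    obtain ⟨E', x', hE, hxx, hunit⟩ := extract_gcd E x
    have hg0 : gcd E x ≠ 0 := fun h => hE0 (by rw [hE, h, zero_mul])
    have hrel : IsRelPrime E' x' := (gcd_isUnit_iff_isRelPrime.mp hunit)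
    have hcolon : (Ideal.span {E} : Submodule (MvPolynomial (Fin (m + 1)) K)
        (MvPolynomial (Fin (m + 1)) K)).colon {x} = Ideal.span {E'} :=
      PhilipponMain.colon_span_singleton_eq hE hxx hg0 hrel
    have h𝔭eq : 𝔭 = Ideal.span {E'} := by rw [hx]; exact hcolon
    have hE'0 : E' ≠ 0 := fun h => hE0 (by rw [hE, h, mul_zero])
    have hE'prime : Prime E' := by
      have h := hprime
      rw [h𝔭eq, Ideal.span_singleton_prime hE'0] at h
      exact h
    rw [h𝔭eq, Literature.RingTheory.KrullDimension.ringKrullDim_quotient_span_of_prime_mvPolynomial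
      hE'prime]
    simp

/-- A form of degree `d ≥ 1` is not a unit. [folklore] -/
theorem not_isUnit_of_isHomogeneous {K : Type*} [Field K] {P : MvPolynomial (Fin (m + 1)) K} {d : ℕ}
    (hP : P.IsHomogeneous d) (hd : 1 ≤ d) (hP0 : P ≠ 0) : ¬ IsUnit P := by
  intro hu
  rw [MvPolynomial.isUnit_iff_totalDegree_of_isReduced] at hu
  have := hP.totalDegree hP0
  omega

/-- **`deg_z (x₀ⁿ A(x/x₀)) ≤ deg_z A`.** [folklore] -/
theorem zDeg_homogTo_le (n : ℕ) (A : Rzx m) : zDeg (homogTo n A) ≤ A.degreeOf 0 := by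
  classical
  refine zDeg_le_of_forall fun d _ => ?_
  rw [homogTo_eq_sum, coeff_sum]
  refine Polynomial.natDegree_sum_le_of_forall_le _ _ fun e he => ?_
  rw [coeff_monomial]
  split_ifs
  · exact (Polynomial.natDegree_monomial_le _).trans (monomial_le_degreeOf 0 he)
  · simp

/-! ### `dim_ℂ 𝓛(μ, ν) = (μ + 1) binom(ν + m, m)` through the parametrisation `LcalParam` -/

/-- `ofCx` preserves homogeneity. [folklore] -/
theorem isHomogeneous_ofCx {H : MvPolynomial (Fin (m + 1)) ℂ} {ν : ℕ} (hH : H.IsHomogeneous ν) :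
    (ofCx H : Czx m).IsHomogeneous ν := by
  intro d hd
  rw [coeff_ofCx] at hd
  exact hH fun h0 => hd (by rw [h0, map_zero])

/-- Coefficients of `LcalParam H`: `Σ_a H_{a,d} zᵃ`. [folklore] -/
theorem coeff_LcalParam {μ ν : ℕ} (H : Fin (μ + 1) → homogeneousSubmodule (Fin (m + 1)) ℂ ν)
    (d : Fin (m + 1) →₀ ℕ) :
    (LcalParam m μ ν H).coeff d =
      ∑ a : Fin (μ + 1), Polynomial.C ((H a : MvPolynomial (Fin (m + 1)) ℂ).coeff d) *
        Polynomial.X ^ (a : ℕ) := by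
  rw [LcalParam_apply, coeff_sum]
  refine Finset.sum_congr rfl fun a _ => ?_
  rw [coeff_C_mul, coeff_ofCx, mul_comm]

/-- The `b`-th coefficient of `Σ_a c_a zᵃ` is `c_b`. [folklore] -/
theorem polynomial_coeff_sum_C_mul_X_pow {μ : ℕ} (c : Fin (μ + 1) → ℂ) (b : Fin (μ + 1)) :
    (∑ a : Fin (μ + 1), Polynomial.C (c a) * Polynomial.X ^ (a : ℕ)).coeff (b : ℕ) = c b := by
  rw [Polynomial.finsetSum_coeff, Finset.sum_eq_single b]
  · rw [Polynomial.coeff_C_mul_X_pow, if_pos rfl]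
  · intro a _ hab
    rw [Polynomial.coeff_C_mul_X_pow, if_neg (fun h => hab (Fin.ext h).symm)]
  · intro h; exact absurd (Finset.mem_univ b) h

/-- Coefficients of `Σ_a c_a zᵃ` beyond `μ` vanish. [folklore] -/
theorem polynomial_coeff_sum_C_mul_X_pow_eq_zero {μ : ℕ} (c : Fin (μ + 1) → ℂ) {b : ℕ} (hb : μ < b) :
    (∑ a : Fin (μ + 1), Polynomial.C (c a) * Polynomial.X ^ (a : ℕ)).coeff b = 0 := by
  rw [Polynomial.finsetSum_coeff]
  refine Finset.sum_eq_zero fun a _ => ?_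
  rw [Polynomial.coeff_C_mul_X_pow, if_neg]
  have := a.isLt
  omega

/-- `LcalParam` takes values in `𝓛(μ, ν)`. [cite: NesterenkoPhilippon2001, Ch. 10 §3 (p. 154)] -/
theorem LcalParam_mem {μ ν : ℕ} (H : Fin (μ + 1) → homogeneousSubmodule (Fin (m + 1)) ℂ ν) :
    LcalParam m μ ν H ∈ Lcal m μ ν := by
  refine ⟨?_, zDeg_le_of_forall fun d _ => ?_⟩
  · rw [LcalParam_apply]
    refine IsHomogeneous.sum _ _ _ fun a _ => ?_
    simpa using (isHomogeneous_C _ (Polynomial.X ^ (a : ℕ))).mul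
      (isHomogeneous_ofCx ((mem_homogeneousSubmodule ν _).mp (H a).2))
  · rw [coeff_LcalParam]
    refine Polynomial.natDegree_sum_le_of_forall_le _ _ fun a _ => ?_
    refine (Polynomial.natDegree_C_mul_le _ _).trans ?_
    rw [Polynomial.natDegree_pow, Polynomial.natDegree_X, mul_one]
    have := a.isLt
    omega

/-- `LcalParam` is injective. [folklore] -/
theorem LcalParam_injective (μ ν : ℕ) : Function.Injective (LcalParam m μ ν) := by
  refine (injective_iff_map_eq_zero _).mpr fun H hH => ?_
  funext b
  refine Subtype.ext ?_
  ext d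
  have h1 := congrArg (fun P : Czx m => (P.coeff d).coeff (b : ℕ)) hH
  simp only [coeff_LcalParam, coeff_zero, Polynomial.coeff_zero] at h1
  rw [polynomial_coeff_sum_C_mul_X_pow] at h1
  simpa using h1

/-- **`𝓛(μ, ν)` is the range of `LcalParam`**: every form of degree `ν` with `deg_z ≤ μ` is
`Σ_{a ≤ μ} zᵃ H_a` with complex forms `H_a` of degree `ν`. [cite: NesterenkoPhilippon2001, Ch. 10 §3 (p. 154)] -/
theorem Lcal_eq_range (μ ν : ℕ) : Lcal m μ ν = LinearMap.range (LcalParam m μ ν) := by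
  refine le_antisymm ?_ ?_
  · rintro P ⟨hPh, hPz⟩
    classical
    -- the complex forms `H_a = Σ_d (P_d)_a x^d`
    have hHa : ∀ a : Fin (μ + 1),
        (∑ d ∈ P.support, monomial d ((P.coeff d).coeff (a : ℕ)) : MvPolynomial (Fin (m + 1)) ℂ) ∈
          homogeneousSubmodule (Fin (m + 1)) ℂ ν := by
      intro a
      rw [mem_homogeneousSubmodule]
      refine IsHomogeneous.sum _ _ _ fun d hd => isHomogeneous_monomial _ ?_
      rw [Finsupp.degree_eq_weight_one]
      exact hPh (mem_support_iff.mp hd)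
    refine ⟨fun a => ⟨_, hHa a⟩, MvPolynomial.ext _ _ fun d => ?_⟩
    have hc : ∀ a : Fin (μ + 1),
        ((∑ d' ∈ P.support, monomial d' ((P.coeff d').coeff (a : ℕ)) :
          MvPolynomial (Fin (m + 1)) ℂ)).coeff d = (P.coeff d).coeff (a : ℕ) := by
      intro a
      rw [coeff_sum]
      simp only [coeff_monomial, Finset.sum_ite_eq']
      split_ifs with h
      · rfl
      · rw [MvPolynomial.notMem_support_iff.mp h, Polynomial.coeff_zero]
    rw [coeff_LcalParam]
    simp only [hc]
    -- `P_d = Σ_{a ≤ μ} (P_d)_a zᵃ` since `deg P_d ≤ μ`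
    have hdeg : (P.coeff d).natDegree < μ + 1 :=
      Nat.lt_succ_of_le ((natDegree_coeff_le_zDeg P d).trans hPz)
    conv_rhs => rw [(P.coeff d).as_sum_range_C_mul_X_pow' hdeg]
    rw [Finset.sum_range (fun i => Polynomial.C ((P.coeff d).coeff i) * Polynomial.X ^ i)]
  · rintro _ ⟨H, rfl⟩
    exact LcalParam_mem H

/-- **`𝓛(μ, ν)` is finite-dimensional.** [cite: NesterenkoPhilippon2001, Ch. 10 §3 (p. 154)] -/
theorem finite_Lcal (μ ν : ℕ) : Module.Finite ℂ (Lcal m μ ν) := by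
  haveI := fun ν =>
    Literature.RingTheory.MvPolynomial.finite_homogeneousSubmodule (K := ℂ) (σ := Fin (m + 1)) ν
  have e : (Fin (μ + 1) → homogeneousSubmodule (Fin (m + 1)) ℂ ν) ≃ₗ[ℂ] Lcal m μ ν :=
    (LinearEquiv.ofInjective (LcalParam m μ ν) (LcalParam_injective μ ν)).trans
      (LinearEquiv.ofEq _ _ (Lcal_eq_range μ ν).symm)
  exact Module.Finite.equiv e

/-- **`dim_ℂ 𝓛(μ, ν) = (μ + 1) binom(ν + m, m)`.** [cite: NesterenkoPhilippon2001, Ch. 10 §3, proof of Lemma 3.2 (p. 154)] -/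
theorem finrank_Lcal (μ ν : ℕ) :
    Module.finrank ℂ (Lcal m μ ν) = (μ + 1) * (ν + m).choose ν := by
  have e : (Fin (μ + 1) → homogeneousSubmodule (Fin (m + 1)) ℂ ν) ≃ₗ[ℂ] Lcal m μ ν :=
    (LinearEquiv.ofInjective (LcalParam m μ ν) (LcalParam_injective μ ν)).trans
      (LinearEquiv.ofEq _ _ (Lcal_eq_range μ ν).symm)
  haveI := fun ν =>
    Literature.RingTheory.MvPolynomial.finite_homogeneousSubmodule (K := ℂ) (σ := Fin (m + 1)) ν
  rw [← e.finrank_eq, Module.finrank_pi_fintype, Finset.sum_const, Finset.card_univ,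
    Fintype.card_fin, smul_eq_mul, Literature.RingTheory.HilbertSamuel.finrank_homogeneousSubmodule_fin]
  congr 1

/-- `𝓛_𝔭(μ, ν)` is finite-dimensional. [folklore] -/
theorem finite_LcalMod (𝔭 : Ideal (Kx m)) (μ ν : ℕ) : Module.Finite ℂ (LcalMod 𝔭 μ ν) := by
  haveI := finite_Lcal (m := m) μ ν
  unfold LcalMod
  infer_instance

/-- **(53) ⇒ Lemma 3.2**: if `χ_𝔭(μ, ν) < dim_ℂ 𝓛(μ, ν)` then some non-zero `P ∈ 𝓛(μ, ν)` has residue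
`0` modulo `𝔭`, i.e. `P ∈ 𝔭 ∩ ℂ[z, x̲]` is a form of `x̲`-degree `ν` with `deg_z P ≤ μ`.
[cite: NesterenkoPhilippon2001, Ch. 10 Lemma 3.2, proof, (53) (p. 154)] -/
theorem exists_mem_Lcal_toK_mem {𝔭 : Ideal (Kx m)} {μ ν : ℕ}
    (h : charFn 𝔭 μ ν < Module.finrank ℂ (Lcal m μ ν)) :
    ∃ P : Czx m, P ≠ 0 ∧ P.IsHomogeneous ν ∧ zDeg P ≤ μ ∧ toK P ∈ 𝔭 := by
  haveI := finite_Lcal (m := m) μ ν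
  set f : Czx m →ₗ[ℂ] Kx m ⧸ 𝔭 :=
    ((Ideal.Quotient.mkₐ ℂ 𝔭).toLinearMap).comp (toKₐ (m := m)).toLinearMap with hf
  set g : Lcal m μ ν →ₗ[ℂ] Kx m ⧸ 𝔭 := f.comp (Lcal m μ ν).subtype with hg
  have hrange : LinearMap.range g = LcalMod 𝔭 μ ν := by
    rw [hg, LinearMap.range_comp, Submodule.range_subtype]; rfl
  have hrn := LinearMap.finrank_range_add_finrank_ker (K := ℂ) (V := Lcal m μ ν) (V₂ := Kx m ⧸ 𝔭) g
  rw [hrange] at hrn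
  have hker : 0 < Module.finrank ℂ (LinearMap.ker g) := by
    unfold charFn at h; omega
  have hkerne : LinearMap.ker g ≠ ⊥ := by
    intro h
    rw [h, finrank_bot] at hker
    exact lt_irrefl _ hker
  obtain ⟨⟨P, hPL⟩, hPker, hP0⟩ := Submodule.exists_mem_ne_zero_of_ne_bot hkerne
  refine ⟨P, fun h0 => hP0 ?_, hPL.1, hPL.2, ?_⟩
  · exact Subtype.ext h0
  · rw [LinearMap.mem_ker] at hPker
    change Ideal.Quotient.mk 𝔭 (toK P) = 0 at hPker
    exact Ideal.Quotient.eq_zero_iff_mem.mp hPker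

/-- `m! · binom(ν + m, m) > νᵐ` ("`dim 𝓛(μ, ν) = (μ+1) binom(ν+m, m) > (m!)⁻¹ (μ+1) νᵐ`", p. 154):
`m! binom(ν + m, m) = (ν + 1)(ν + 2) ⋯ (ν + m) ≥ (ν + 1)ᵐ`. [cite: NesterenkoPhilippon2001, Ch. 10 §3, proof of Lemma 3.2 (p. 154)] -/
theorem pow_lt_factorial_mul_choose {m : ℕ} (hm : 1 ≤ m) (ν : ℕ) :
    ν ^ m < m.factorial * (ν + m).choose ν := by
  rw [Nat.choose_symm_add, ← Nat.descFactorial_eq_factorial_mul_choose]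
  calc ν ^ m < (ν + 1) ^ m := Nat.pow_lt_pow_left (Nat.lt_succ_self ν) (by omega)
    _ = (ν + m + 1 - m) ^ m := by congr 1; omega
    _ ≤ (ν + m).descFactorial m := Nat.pow_sub_le_descFactorial _ _

/-- A prime ideal is its own minimal primary decomposition. [folklore] -/
theorem isMinimalPrimaryDecomposition_singleton {R : Type*} [CommRing R] {𝔭 : Ideal R}
    (h𝔭 : 𝔭.IsPrime) : Submodule.IsMinimalPrimaryDecomposition 𝔭 {𝔭} where
  inf_eq := by simp
  primary := fun J hJ => by rw [Finset.mem_singleton.mp hJ]; exact h𝔭.isPrimary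
  distinct := by simp
  minimal := fun J hJ => by
    rw [Finset.mem_singleton.mp hJ]
    simp only [Finset.erase_singleton, Finset.inf_empty]
    exact fun h => h𝔭.ne_top (top_le_iff.mp h)

/-- **`deg 𝔭 ≥ 1`** for a homogeneous prime `𝔭` of `K[x₀, …, x_m]` with `1 ≤ r = dim 𝔭 + 1 ≤ m`
(the associated form is irreducible, Prop. 4.4, hence involves the block `u₁`; all blocks have the
same degree). [cite: NesterenkoPhilippon2001, Ch. 3 Prop. 4.4, Def. 4.5 (p. 38)] -/
theorem one_le_ideg_of_isPrime {r : ℕ} {𝔭 : Ideal (Kx m)} (hr1 : 1 ≤ r) (hrm : r ≤ m)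
    (hprime : 𝔭.IsPrime) (hhom : 𝔭.IsHomogeneous (homogeneousSubmodule (Fin (m + 1)) (RatFunc ℂ)))
    (hunm : IsUnmixedOfRank 𝔭 r) : 1 ≤ ideg 𝔭 r := by
  classical
  obtain ⟨-, -, hF, hblock⟩ := prop_4_4 m r 𝔭 hr1 hrm hhom hunm {𝔭}
    (isMinimalPrimaryDecomposition_singleton hprime)
  -- the associated form is irreducible
  have hirr : Irreducible (chowForm 𝔭 r) := by
    have h := (hF (fun _ => chowForm 𝔭 r) (fun Q hQ => by
      rw [Finset.mem_singleton.mp hQ, hprime.radical]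
      exact span_chowForm 𝔭 r (by
        obtain ⟨h1, -⟩ := prop_4_4 m r 𝔭 hr1 hrm hhom hunm {𝔭}
          (isMinimalPrimaryDecomposition_singleton hprime)
        exact h1))).1
    exact h 𝔭 (Finset.mem_singleton_self 𝔭)
  -- hence non-constant: some variable occurs
  have hF0 : chowForm 𝔭 r ≠ 0 := hirr.ne_zero
  have hne : (chowForm 𝔭 r).totalDegree ≠ 0 := by
    intro h0
    rw [totalDegree_eq_zero_iff_eq_C] at h0
    have hc : (chowForm 𝔭 r).coeff 0 ≠ 0 := fun hc0 => hF0 (by rw [h0, hc0, C_0])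
    have hu : IsUnit (chowForm 𝔭 r) := by
      rw [h0]; exact (isUnit_iff_ne_zero.mpr hc).map C
    exact hirr.not_isUnit hu
  obtain ⟨d, hd, hdeg⟩ := Finset.exists_mem_eq_sup (chowForm 𝔭 r).support
    (support_nonempty.mpr hF0) (fun s => s.sum fun _ e => e)
  have hd0 : d ≠ 0 := by
    intro h
    apply hne
    rw [totalDegree, hdeg, h]
    simp
  obtain ⟨⟨i, j⟩, hij⟩ : ∃ v, d v ≠ 0 := by
    by_contra h
    push Not at h
    exact hd0 (Finsupp.ext h)
  have h1 : 1 ≤ blockDeg (chowForm 𝔭 r) i :=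
    calc 1 ≤ d (i, j) := Nat.one_le_iff_ne_zero.mpr hij
      _ ≤ ∑ j', d (i, j') := Finset.single_le_sum (f := fun j' => d (i, j'))
          (fun _ _ => Nat.zero_le _) (Finset.mem_univ j)
      _ ≤ blockDeg (chowForm 𝔭 r) i := sum_le_blockDeg hd i
  rw [hblock i] at h1
  exact h1

variable {L : Type*} [NormedField L] [Algebra (RatFunc ℂ) L]
  {hgt : Ideal (Kx m) → ℕ → ℝ} {hgtP : Kx m → ℝ} {γ₁ : ℝ}

/-- **LNM 1752 Ch. 10 Lemma 3.2.** Under Lemma 3.1 (field `lemma_3_1` of the toolkit), if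
`ν^{m−r+1} ≥ γ₂ deg 𝔭` and `(μ + 1) ν^{m−r} ≥ γ₂ h(𝔭)` with `γ₂ = 2 · m! · γ₁` (52), then there is a
polynomial `P ∈ 𝔭 ∩ ℂ[z, x̲]`, homogeneous in `x̲`, with `deg_x̲ P = ν` and `deg_z P ≤ μ` (and `P ≠ 0`).
Proof as printed: `χ_𝔭(μ, ν) ≤ γ₁((μ+1)ν^{r−1} deg 𝔭 + ν^r h(𝔭)) ≤ (m!)⁻¹(μ+1)νᵐ < dim 𝓛(μ, ν)` (53).
[cite: NesterenkoPhilippon2001, Ch. 10 Lemma 3.2 and its proof (p. 154)] -/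
theorem lemma_3_2 (T : CzToolkit m L hgt hgtP γ₁) {r : ℕ} {𝔭 : Ideal (Kx m)}
    (hr1 : 1 ≤ r) (hrm : r ≤ m) (hprime : 𝔭.IsPrime)
    (hhom : 𝔭.IsHomogeneous (homogeneousSubmodule (Fin (m + 1)) (RatFunc ℂ)))
    (hunm : IsUnmixedOfRank 𝔭 r) {μ ν : ℕ} (hν : 1 ≤ ν)
    (h52a : 2 * (m.factorial : ℝ) * γ₁ * (ideg 𝔭 r : ℝ) ≤ (ν : ℝ) ^ (m - r + 1))
    (h52b : 2 * (m.factorial : ℝ) * γ₁ * hgt 𝔭 r ≤ ((μ : ℝ) + 1) * (ν : ℝ) ^ (m - r)) :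
    ∃ P : Czx m, P ≠ 0 ∧ P.IsHomogeneous ν ∧ zDeg P ≤ μ ∧ toK P ∈ 𝔭 := by
  apply exists_mem_Lcal_toK_mem
  have hχ := T.lemma_3_1 r 𝔭 hr1 hrm hprime hhom hunm μ ν hν
  have hγ := T.one_le_gamma
  have hfact : (0 : ℝ) < m.factorial := by exact_mod_cast m.factorial_pos
  set D : ℝ := (ideg 𝔭 r : ℝ) with hD
  set H : ℝ := hgt 𝔭 r with hH
  have hD0 : 0 ≤ D := Nat.cast_nonneg _
  have hH0 : 0 ≤ H := T.hgt_nonneg _ _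
  have hν0 : (0 : ℝ) ≤ ν := Nat.cast_nonneg _
  have hνpow : (ν : ℝ) ^ (r - 1) * (ν : ℝ) ^ (m - r + 1) = (ν : ℝ) ^ m := by
    rw [← pow_add]; congr 1; omega
  have hνpow' : (ν : ℝ) ^ r * (ν : ℝ) ^ (m - r) = (ν : ℝ) ^ m := by
    rw [← pow_add]; congr 1; omega
  have hA : 2 * (m.factorial : ℝ) * γ₁ * (((μ : ℝ) + 1) * (ν : ℝ) ^ (r - 1) * D) ≤
      ((μ : ℝ) + 1) * (ν : ℝ) ^ m := by
    calc 2 * (m.factorial : ℝ) * γ₁ * (((μ : ℝ) + 1) * (ν : ℝ) ^ (r - 1) * D)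
        = ((μ : ℝ) + 1) * (ν : ℝ) ^ (r - 1) * (2 * (m.factorial : ℝ) * γ₁ * D) := by ring
      _ ≤ ((μ : ℝ) + 1) * (ν : ℝ) ^ (r - 1) * (ν : ℝ) ^ (m - r + 1) := by gcongr
      _ = ((μ : ℝ) + 1) * (ν : ℝ) ^ m := by rw [mul_assoc, hνpow]
  have hB : 2 * (m.factorial : ℝ) * γ₁ * ((ν : ℝ) ^ r * H) ≤ ((μ : ℝ) + 1) * (ν : ℝ) ^ m := by
    calc 2 * (m.factorial : ℝ) * γ₁ * ((ν : ℝ) ^ r * H)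
        = (ν : ℝ) ^ r * (2 * (m.factorial : ℝ) * γ₁ * H) := by ring
      _ ≤ (ν : ℝ) ^ r * (((μ : ℝ) + 1) * (ν : ℝ) ^ (m - r)) := by gcongr
      _ = ((μ : ℝ) + 1) * (ν : ℝ) ^ m := by rw [← hνpow']; ring
  have h1 : (m.factorial : ℝ) * charFn 𝔭 μ ν ≤ ((μ : ℝ) + 1) * (ν : ℝ) ^ m := by
    have h := mul_le_mul_of_nonneg_left hχ hfact.le
    nlinarith
  have h2 : ((ν ^ m : ℕ) : ℝ) < ((m.factorial * (ν + m).choose ν : ℕ) : ℝ) := by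
    exact_mod_cast pow_lt_factorial_mul_choose (by omega) ν
  have h3 : (m.factorial : ℝ) * charFn 𝔭 μ ν <
      (m.factorial : ℝ) * (((μ + 1) * (ν + m).choose ν : ℕ) : ℝ) := by
    have hμ : (0 : ℝ) < (μ : ℝ) + 1 := by positivity
    push_cast at h2 ⊢
    calc (m.factorial : ℝ) * charFn 𝔭 μ ν ≤ ((μ : ℝ) + 1) * (ν : ℝ) ^ m := h1
      _ < ((μ : ℝ) + 1) * ((m.factorial : ℝ) * ((ν + m).choose ν : ℝ)) := by gcongr
      _ = (m.factorial : ℝ) * (((μ : ℝ) + 1) * ((ν + m).choose ν : ℝ)) := by ring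
  have h4 : (charFn 𝔭 μ ν : ℝ) < (((μ + 1) * (ν + m).choose ν : ℕ) : ℝ) :=
    lt_of_mul_lt_mul_left h3 hfact.le
  rw [finrank_Lcal]
  exact_mod_cast h4

omit [NormedField L] [Algebra (RatFunc ℂ) L] in
/-- **Corollary 3.3, the choice of parameters (54)**: with `γ₂ ≥ 1`, `deg ≥ 1`, `h ≥ 0`,
`k = m − r + 1 ≥ 1`, `ν = 1 + [γ₂ deg^{1/k}]` and `μ = [γ₂ h deg^{−(k−1)/k}]` satisfy (52):
`ν^k ≥ γ₂ deg` and `(μ + 1) ν^{k−1} ≥ γ₂ h` ("It is easy to check that chosen parameters `ν, μ`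
satisfy (52)"). [cite: NesterenkoPhilippon2001, Ch. 10 Corollary 3.3 and its proof, (54) (p. 154)] -/
theorem cor_3_3_ineq {γ₂ dg h : ℝ} (hγ₂ : 1 ≤ γ₂) (hdg : 1 ≤ dg) (hh : 0 ≤ h) {k : ℕ} (hk : 1 ≤ k)
    {ν μ : ℕ} (hν : ν = 1 + ⌊γ₂ * dg ^ (1 / (k : ℝ))⌋₊)
    (hμ : μ = ⌊γ₂ * h * dg ^ (-(((k : ℝ) - 1) / k))⌋₊) :
    γ₂ * dg ≤ (ν : ℝ) ^ k ∧ γ₂ * h ≤ ((μ : ℝ) + 1) * (ν : ℝ) ^ (k - 1) := by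
  have hdg0 : 0 < dg := by linarith
  have hk0 : (k : ℝ) ≠ 0 := by exact_mod_cast (show k ≠ 0 by omega)
  set x : ℝ := γ₂ * dg ^ (1 / (k : ℝ)) with hx
  set y : ℝ := γ₂ * h * dg ^ (-(((k : ℝ) - 1) / k)) with hy
  have hx0 : 0 ≤ x := by positivity
  have hy0 : 0 ≤ y := by positivity
  have hxν : x ≤ ν := by
    rw [hν]; push_cast
    have := Nat.lt_floor_add_one x
    linarith
  have hyμ : y ≤ (μ : ℝ) + 1 := by
    rw [hμ]
    exact (Nat.lt_floor_add_one y).le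
  -- `x^k = γ₂^k dg`
  have hxk : x ^ k = γ₂ ^ k * dg := by
    rw [hx, mul_pow, one_div, Real.rpow_inv_natCast_pow hdg0.le (by omega)]
  have hγk : γ₂ ≤ γ₂ ^ k := by
    calc γ₂ = γ₂ ^ 1 := (pow_one γ₂).symm
      _ ≤ γ₂ ^ k := pow_le_pow_right₀ hγ₂ hk
  refine ⟨?_, ?_⟩
  · calc γ₂ * dg ≤ γ₂ ^ k * dg := by gcongr
      _ = x ^ k := hxk.symm
      _ ≤ (ν : ℝ) ^ k := pow_le_pow_left₀ hx0 hxν k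
  · -- `y · x^{k−1} = γ₂^k h`
    have hxk1 : x ^ (k - 1) = γ₂ ^ (k - 1) * dg ^ (((k : ℝ) - 1) / k) := by
      rw [hx, mul_pow, ← Real.rpow_mul_natCast hdg0.le]
      congr 2
      rw [Nat.cast_sub hk, Nat.cast_one]
      field_simp
    have hprod : y * x ^ (k - 1) = γ₂ ^ k * h := by
      rw [hxk1, hy]
      have e : dg ^ (-(((k : ℝ) - 1) / k)) * dg ^ (((k : ℝ) - 1) / k) = 1 := by
        rw [← Real.rpow_add hdg0, neg_add_cancel, Real.rpow_zero]
      calc γ₂ * h * dg ^ (-(((k : ℝ) - 1) / k)) * (γ₂ ^ (k - 1) * dg ^ (((k : ℝ) - 1) / k))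
          = γ₂ * γ₂ ^ (k - 1) * h * (dg ^ (-(((k : ℝ) - 1) / k)) * dg ^ (((k : ℝ) - 1) / k)) := by
            ring
        _ = γ₂ ^ k * h := by
            rw [e, mul_one, ← pow_succ', Nat.sub_add_cancel hk]
    calc γ₂ * h ≤ γ₂ ^ k * h := by gcongr
      _ = y * x ^ (k - 1) := hprod.symm
      _ ≤ ((μ : ℝ) + 1) * (ν : ℝ) ^ (k - 1) := by
          gcongr

end Lemma32

end NesterenkoMultiplicity

end Literature.NumberTheory.Transcendental

end
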